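import Literature.MathematicalPhysics.QuantumFieldTheory.Balaban1983to89.B2Prop22RegularRegionPair

/-!
# `Balaban1983to89.B2Prop22RegularTorusPair` — [Balaban1982Higgs2] **Proposition 2.2** (2.58) pp. 570–571 AT EVERY
# (I.2.23)/(1.7)-REGULAR VECTOR FIELD `A ≠ 0` ON THE FAMILY OF TORUS REGION PAIRS `Ω ⊂ Ω₀ ⊂ T_η` — the paper's own setting
# («operators on subsets of a torus T_η»): r14's decl of record `B2StepK.Prop22Printed` INHABITED through p17's bridge fed with
# r01's PROVED torus form of [Balaban1983RegularityDecay] Theorem p. 573 (`B4ThmTorusPairEta.thmPrintedNN_torusPairFam`,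
# p318600), plus (2.58) at EVERY bond when `Ω` is the whole torus (the print's waiver of the `R₀` restriction)

statement-level skeleton of published theorems with citation tags; proofs where landed; nothing here is a claim about the Yang–Mills mass gap

PDF held: `paper:balaban1982-cmp86-higgs23-ii` (journal page = PDF page + 554); II pp. 570–571 re-read on the ×2 render
`run/shared/lean/pub/pub-balaban/b2b-balaban-ref1/pages/1982-cmp86-higgs23-II/1982-cmp86-higgs23-II-p017-x2.png` and the text
layer (`p0016.txt` L31–34, `p0017.txt` L1–5); [Balaban1983RegularityDecay] p. 572 «operators on subsets of a torus T_η
which we identify with a rectangular parallelepiped in ηZ^d with periodic conditions», p. 573 Theorem + «For some simple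
sets Ω, e.g. for rectangular parallelepipeds, the inequalities hold without any restrictions on the points x, x′».

CITATION HEADER (lean-in-tree rule).  T. Bałaban, *(Higgs)₂,₃ quantum fields in a finite volume. II. An upper bound*,
Commun. Math. Phys. **86** (1982) 555–594 [Balaban1982Higgs2], Prop. 2.2 (2.58) pp. 570–571; T. Bałaban, *Regularity and
decay of lattice Green's functions*, Commun. Math. Phys. **89** (1983) 571–597 [Balaban1983RegularityDecay], Theorem p. 573.
Cell `lit-balaban`, Phase-2 proof seat **p23** gen 14 (unit `lit-balaban-p23-g14`), sibling of `B2Prop22RegularRegionPair`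
(same seat; the `ηℤ^{d+1}` pairs); SKELETON row **B2.Prop2.2** (fold owner r02, twin r14; decl of record
`B2StepK.Prop22Printed`, r14 p239461 — UNCHANGED), xref rows B1.Prop2.1 / B4.Thm@573; kind «knitting at a regular field
A ≠ 0 on the torus»; no head claim.  USED BY NAME, NOTHING RESTATED: p17 g2 `B2Prop22Proof.{Dict, Dict.toP22,
prop22Printed_of_B4clause, bound_plain}`; r01 g9 `B4TorusPairFam.{TorusPairInst (.HT/.GT/.G₀T/.DT/.D₀T/.deltaT/.extT/.resT,
extT_of_mem, extT_of_not_mem, fld_deltaT, fld_DT_deltaT), torusPairFam, tsupp, tsdist1, tcdist, tbdistS, mem_tsupp_of_ne,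
tcdist_le}`, `B4ThmTorusPairEta.{thmPrintedNN_torusPairFam, hypotheses_met}` (p318600), `B4TorusRegionOp.{torusOp, torBond,
torWt, twrap, per, tnorm, tnorm_le_supNorm, tnorm_add_per, exists_lift_eq_tnorm}`, `B4ThmRegionPairEta.Kmod`,
`B4RegionCubeCarrier.{incl, inclY, inReg_iff, contourTrans_incl}`, `B4Eq12ExpFlow.{expFlow, expFlow_lipschitz}`; this seat's
`B2Prop22RegularRegionPair.{avgQ, single, srcQ, fld_srcQ, supN_srcQ_le, srcQ_apply_eq_zero_of_blk_ne, exists_srcQ_apply_ne_zero,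
fld_mul_avgQ_transpose_mulVec_single, srcQ_smul, supNorm_sub_base_le, siteNorm_fld_mulVec_single_le, Sphere, sphere_nonempty,
homog_bound_of_sphere, bddAbove_sphere_of_homog}`.

WHAT IS PRINTED (verbatim, II pp. 570–571): *"**Proposition 2.2.** Let Ω and A satisfy the assumptions of Proposition I.2.1,
then for e(L^kε) sufficiently small there exist positive constants δ₀, c₀, R₀ independent of A, k, Ω and depending on d, a,
M, such that |(D^η_AG_k(Ω, A)Q_k^*(A))(b, y)| ≦ c₀ exp(−δ₀ dist(b, y)),  (2.58)  for b ⊂ Ω, dist(b, Ωᶜ) ≧ R₀, y ∈ Ω^{(k)}. The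
identical inequality holds for G_k(Ω, A)Q_k^*(A), and for D^η_AδG_k(Ω,Ω₀, A)Q_k^*(A), δG_k(Ω,Ω₀, A)Q_k^*(A) with the additional
factor exp(−δ₀(dist(b,Ωᶜ) + dist(y,Ωᶜ))).  This proposition is a simple corollary of Proposition I.2.1."*  In [Balaban1982Higgs2]
`Ω ⊂ T_η` is a region of the torus (`T_ε` of I p. 605 / II p. 556; p. 570 the regions `Λ^{(k−1)′}`), which is the setting of this file.

WHAT THIS MODULE PROVES (kernel-checked, 0 `sorry`, no new `def … : Prop`; axioms standard).
* §1 TORUS GEOMETRY: **`tnorm_add_le`** (the torus sup-norm `|·|_T` is subadditive — lift both summands to nearest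
  representatives), **`tcdist_le_tcdist_add`** (`dist_T(·, Ωᶜ)` is 1-Lipschitz), `tor_mem_tsupp`, `le_tsdist1`, `le_tbdistS`; for
  the source `f_{y,v} = srcQ …` of the sibling file on a torus region (any bond function): `blk_eq_of_mem_tsupp_srcQ`,
  `base_mem_tsupp_srcQ`, **`tdxy_le_tsdist1_srcQ`** (`|x − L^ky|_T ≤ dist_T(x, supp f_{y,v}) + 1`), **`tydist_le_tbdistS_srcQ`**
  (`dist_T(L^ky, Ωᶜ) ≤ dist_T(supp f_{y,v}, Ωᶜ) + 1`).
* §2 for a member `i` of `torusPairFam`: `tbond` (the torus bond function of the member's field), **`HT_eq_avgQ`** (the carrier's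
  (1.6) operator IS `−Δ_A + m² + a_k·(avgQ)ᵀ(avgQ)` — definitional; so `Q_k^*(A)` here is the one inside `G_k(Ω,A)`), `tsrc` /
  `tsrc₀` (`Q_k^*(A)(vδ_y)` on `Ω` / on `Ω₀`), `tbase`, `tldist` (`dist(x,y) = |x − L^ky|_T` in unit-lattice units), **`extT_tsrc`**
  (`E(Q_k^{*,Ω}(A)(vδ_y)) = Q_k^{*,Ω₀}(A)(vδ_y)`), `deltaT_smul`, the four homogeneous bounds `valG_tsrc_le` / `valDG_tsrc_le` /
  `dvalG_tsrc_le` / `dvalDG_tsrc_le` (the sphere suprema defining the kernels are suprema of bounded families), **`torDict`** = p17's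
  `Dict 1` at the member with every dictionary hypothesis discharged, `kGQ_torDict`.
* §3 **`prop22Printed_torusPairFam`**: `B2StepK.Prop22Printed (fun i => (torDict U c β Kmod i).toP22)` — PROP. 2.2 AT EVERY
  (1.7)-REGULAR TORUS FIELD on r01's family (every scale `k ≥ 1`, every torus `Π_ν ℤ/(L^kP_ν)` with `Kmod ∣ P_ν`, EVERY pair
  `Ω ⊂ Ω₀ ⊂ T_η` of unions of `Kmod`-blocks, every field regular on `Ω₀`, `0 < e ≤ e₁`); `prop22Printed_torusPairFam_exp`
  (printed links `e^{qeηA}`); `torusPairFam_nonvacuous`; **`ineq258_torusPairFam`** — (2.58) EXPLICITLY, all four clauses, every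
  `v ∈ ℝ^N`, at `dist_T(x, Ωᶜ) ≥ R₀` (bonds = torus bonds of `Ω`); **`ineq258_torus_rect`** — for members with `Ω = T_η` the two plain
  clauses at EVERY point / bond with NO `R₀` restriction (the typed restriction `R₀ ≤ dist(x, Ωᶜ)` of `Prop22Printed` is never met
  there since `dist_T(x, ∅) := 0`; this is the print's waiver for rectangular parallelepipeds, via the `rect` branch of r01's
  `Ineq19_110` at α = 0 and p17's `bound_plain`, `c₀ ↦ c₀e^{2δ₀}`).
HONEST SCOPE.  (i) KNITTING: the analysis is r01's torus form of [Balaban1983RegularityDecay] Theorem (periodic lifting of the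
lattice theorem, B4 sub-cell), the bridge p17's; no new estimate.  (ii) Carriers = r01's readings: abelian one-parameter
orthogonal flow (1.2), `N = |ι| ≥ 1`, torus component fields on the period box, unit blocks that do not wrap (`rBlkWt`,
staircase contours from the base corner), fine period `L^kP_ν ≥ 3`, torus sup-metric in unit-lattice units; constants
`δ₀, c₀, R₀, e₁` of r01's α = 0 clause (functions of `d, L, a₋, a₊, m²₊, c, β, ℓ₁` only — «independent of A, k, Ω»).  The
(Higgs)₂,₃ carrier `HiggsCovariance.avgQkAdj` (composite contours I (2.11)) is not a member of this family (p35's note).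
(iii) READINGS in the faithful direction as in the sibling file: operator norm of the `N × N` block; `y` as the point `L^ky`;
bonds read at `b₋`; the `δG_k` source on `Ω₀` is the same `Q_k^*(A)(vδ_y)` (`extT_tsrc`).  (iv) The `δG_k` clauses are not
restated in `ineq258_torus_rect` (for `Ω = T_η` one has `Ω₀ = Ω` and `δG_k = 0`).  (v) No row head changes (owner r02).
Nothing here is summit progress.
-/

namespace Literature.MathematicalPhysics.QuantumFieldTheory.Balaban1983to89.B2Prop22RegularTorusPair

open Literature.MathematicalPhysics.QuantumFieldTheory.Balaban1983to89
open Literature.MathematicalPhysics.QuantumFieldTheory.Balaban1983to89.B4GaugeCovariance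
open Literature.MathematicalPhysics.QuantumFieldTheory.Balaban1983to89.B4 (Ineq19_110)
open Literature.MathematicalPhysics.QuantumFieldTheory.Balaban1983to89.B4Reflection242 (blk blk_mul boxDom supNorm_add_le)
open Literature.MathematicalPhysics.QuantumFieldTheory.Balaban1983to89.B4ContourShift (supNorm supNorm_nonneg)
open Literature.MathematicalPhysics.QuantumFieldTheory.Balaban1983to89.B4Lower18 (fineDom mem_fineDom)
open Literature.MathematicalPhysics.QuantumFieldTheory.Balaban1983to89.B4Lower18Regular (e1)
open Literature.MathematicalPhysics.QuantumFieldTheory.Balaban1983to89.B4Lower18RegularRegion (rBlkWt rbaseEmb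
  rstairContour rbaseEmb_blk)
open Literature.MathematicalPhysics.QuantumFieldTheory.Balaban1983to89.B4Lemma21Region (siteNorm)
open Literature.MathematicalPhysics.QuantumFieldTheory.Balaban1983to89.B4Lemma22Reduce231 (supN supN_nonneg siteNorm_nonneg
  siteNorm_smul)
open Literature.MathematicalPhysics.QuantumFieldTheory.Balaban1983to89.B4TorusRegionOp (per per_pos twrap tnorm tnorm_nonneg
  tnorm_le_supNorm tnorm_add_per exists_lift_eq_tnorm torBond torusOp torWt)
open Literature.MathematicalPhysics.QuantumFieldTheory.Balaban1983to89.B4TorusPairFam (tsupp tsdist1 tcdist tbdistS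
  TorusPairInst torusPairFam mem_tsupp_of_ne eq_zero_of_not_mem_tsupp tsdist1_le tcdist_le tbdistS_le tcdist_nonneg)
open Literature.MathematicalPhysics.QuantumFieldTheory.Balaban1983to89.B4ThmRegionPairEta (Kmod)
open Literature.MathematicalPhysics.QuantumFieldTheory.Balaban1983to89.B4ThmTorusPairEta (thmPrintedNN_torusPairFam)
open Literature.MathematicalPhysics.QuantumFieldTheory.Balaban1983to89.B4Eq12ExpFlow (expFlow expFlow_lipschitz)
open Literature.MathematicalPhysics.QuantumFieldTheory.Balaban1983to89.B2Prop22Proof (Dict bound_plain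
  prop22Printed_of_B4clause)
open Literature.MathematicalPhysics.QuantumFieldTheory.Balaban1983to89.B2Prop22RegularRegionPair (avgQ single srcQ fld_srcQ
  siteNorm_fld_srcQ supN_srcQ_le srcQ_apply_eq_zero_of_blk_ne exists_srcQ_apply_ne_zero fld_mul_avgQ_transpose_mulVec_single
  srcQ_smul supNorm_sub_base_le siteNorm_fld_mulVec_single_le Sphere sphere_nonempty homog_bound_of_sphere
  bddAbove_sphere_of_homog)
open scoped Matrix

noncomputable section

variable {d : ℕ} {ι : Type} [Fintype ι] [DecidableEq ι]

/-! ## §1. Torus geometry: the triangle inequality of `|·|_T` and the Lipschitz property of `dist_T(·, Ω^c)` -/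

/-- **the torus sup-norm is subadditive**: `|a + b|_T ≤ |a|_T + |b|_T` (lift both to nearest representatives).
[cite: Balaban1983RegularityDecay, p.572 «a torus T_η … with periodic conditions», dictionary] -/
theorem tnorm_add_le {n : ℕ} (hn : 1 ≤ n) {P : Fin (d + 1) → ℕ} (hP : ∀ ν, 1 ≤ P ν) (a b : Fin (d + 1) → ℤ) :
    tnorm n P (a + b) ≤ tnorm n P a + tnorm n P b := by
  obtain ⟨s, hs⟩ := exists_lift_eq_tnorm hn hP a
  obtain ⟨t, ht⟩ := exists_lift_eq_tnorm hn hP b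
  have h1 : tnorm n P (a + b)
      = tnorm n P ((a + fun ν => (per n P ν : ℤ) * s ν) + (b + fun ν => (per n P ν : ℤ) * t ν)) := by
    have : (a + fun ν => (per n P ν : ℤ) * s ν) + (b + fun ν => (per n P ν : ℤ) * t ν)
        = (a + b) + fun ν => (per n P ν : ℤ) * (s + t) ν := by
      funext ν; simp only [Pi.add_apply]; ring
    rw [this, tnorm_add_per]
  rw [h1, ← hs, ← ht]
  exact (tnorm_le_supNorm hn hP _).trans (supNorm_add_le _ _)

section Torus

variable {n : ℕ} (hn : 1 ≤ n) (P : Fin (d + 1) → ℕ) (hP : ∀ ν, 1 ≤ P ν) {ΩT : Finset (Fin (d + 1) → ℤ)}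

omit [Fintype ι] [DecidableEq ι] in
include hn hP in
/-- **`dist_T(·, Ω^c)` IS 1-LIPSCHITZ** (unit-lattice units). [cite: Balaban1983RegularityDecay, Theorem p.573 «dist(x, Ω^c)», dictionary] -/
theorem tcdist_le_tcdist_add (u z : ↥(fineDom n ΩT)) :
    tcdist P u ≤ tcdist P z + tnorm n P (u.1 - z.1) / (n : ℝ) := by
  have hnr : (0 : ℝ) ≤ (n : ℝ) := Nat.cast_nonneg n
  by_cases h : (boxDom (per n P) \ fineDom n ΩT).Nonempty
  · have key : ∀ w ∈ boxDom (per n P) \ fineDom n ΩT,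
        tcdist P u - tnorm n P (u.1 - z.1) / (n : ℝ) ≤ tnorm n P (z.1 - w) / (n : ℝ) := by
      intro w hw
      obtain ⟨hw1, hw2⟩ := Finset.mem_sdiff.1 hw
      have h1 := tcdist_le P u hw1 hw2
      have h2 : tnorm n P (u.1 - w) ≤ tnorm n P (u.1 - z.1) + tnorm n P (z.1 - w) := by
        rw [← sub_add_sub_cancel u.1 z.1 w]; exact tnorm_add_le hn hP _ _
      have h3 : tnorm n P (u.1 - w) / (n : ℝ) ≤ tnorm n P (u.1 - z.1) / (n : ℝ) + tnorm n P (z.1 - w) / (n : ℝ) := by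
        rw [← add_div]; exact div_le_div_of_nonneg_right h2 hnr
      linarith
    have h4 : tcdist P u - tnorm n P (u.1 - z.1) / (n : ℝ) ≤ tcdist P z := by
      rw [show tcdist P z = (boxDom (per n P) \ fineDom n ΩT).inf' h (fun w => tnorm n P (z.1 - w) / (n : ℝ)) from by
        unfold tcdist; rw [dif_pos h]]
      exact Finset.le_inf' _ _ key
    linarith
  · have h0 : ∀ x : ↥(fineDom n ΩT), tcdist P x = 0 := fun x => by unfold tcdist; rw [dif_neg h]
    rw [h0, h0, zero_add]
    exact div_nonneg (tnorm_nonneg _ _ _) hnr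

omit [DecidableEq ι] in
/-- membership in the support. [cite: Balaban1983RegularityDecay, (1.9) p.573 «supp f», dictionary] -/
theorem tor_mem_tsupp {f : ↥(fineDom n ΩT) × ι → ℝ} {z : ↥(fineDom n ΩT)} : z ∈ tsupp f ↔ ∃ j, f (z, j) ≠ 0 := by
  refine ⟨fun hz => ?_, fun ⟨j, hj⟩ => mem_tsupp_of_ne f hj⟩
  by_contra h
  have h0 : ∀ j, f (z, j) = 0 := fun j => not_not.mp ((not_exists.mp h) j)
  classical
  unfold tsupp at hz
  obtain ⟨_, j, hj⟩ := Finset.mem_filter.1 hz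
  exact hj (h0 j)

omit [DecidableEq ι] in
/-- a uniform lower bound on the distances to the support bounds `dist_T(x, supp f)` from below.
[cite: Balaban1983RegularityDecay, (1.10) p.573 «dist(x, supp f)», dictionary] -/
theorem le_tsdist1 (x : ↥(fineDom n ΩT)) (f : ↥(fineDom n ΩT) × ι → ℝ) {D : ℝ} (hne : (tsupp f).Nonempty)
    (h : ∀ z ∈ tsupp f, D ≤ tnorm n P (x.1 - z.1) / (n : ℝ)) : D ≤ tsdist1 P x f := by
  unfold tsdist1
  rw [dif_pos hne]
  exact Finset.le_inf' _ _ h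

omit [DecidableEq ι] in
/-- a uniform lower bound on `dist_T(z, Ω^c)`, `z ∈ supp f`, bounds `dist_T(supp f, Ω^c)` from below.
[cite: Balaban1983RegularityDecay, (1.12) p.573 «dist(supp f, Ω^c)», dictionary] -/
theorem le_tbdistS (f : ↥(fineDom n ΩT) × ι → ℝ) {E : ℝ} (hne : (tsupp f).Nonempty)
    (h : ∀ z ∈ tsupp f, E ≤ tcdist P z) : E ≤ tbdistS P f := by
  unfold tbdistS
  rw [dif_pos hne]
  exact Finset.le_inf' _ _ h

variable (F : OrthFlow ι) (κ : ℝ) (B : ↥(fineDom n ΩT) → ↥(fineDom n ΩT) → ℝ)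

/-- the support of `f_{y,v}` lies in `B^k(y)` (labels). [cite: Balaban1982Higgs2, p.570 «Q_k^*(A)», dictionary] -/
theorem blk_eq_of_mem_tsupp_srcQ (y : ↥ΩT) (v : ι → ℝ) {z : ↥(fineDom n ΩT)} (hz : z ∈ tsupp (srcQ F κ hn ΩT B y v)) :
    blk n z.1 = y.1 := by
  obtain ⟨j, hj⟩ := (tor_mem_tsupp).1 hz
  by_contra h
  exact hj (srcQ_apply_eq_zero_of_blk_ne F κ hn ΩT B y v h j)

/-- the base corner `L^ky` lies in the support of `f_{y,v}` (`|v| = 1`). [cite: Balaban1982Higgs2, p.570 «Q_k^*(A)», dictionary] -/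
theorem base_mem_tsupp_srcQ (y : ↥ΩT) (v : Sphere ι) : rbaseEmb hn ΩT y ∈ tsupp (srcQ F κ hn ΩT B y v.1) :=
  (tor_mem_tsupp).2 (exists_srcQ_apply_ne_zero F κ hn ΩT B y (by rw [v.2]; exact one_ne_zero) (rbaseEmb_blk hn ΩT y))

include hP in
/-- **`dist_T(x, L^ky) ≤ dist_T(x, supp f_{y,v}) + 1`**. [cite: Balaban1982Higgs2, (2.58) p.570 «dist(b, y)», dictionary] -/
theorem tdxy_le_tsdist1_srcQ (x : ↥(fineDom n ΩT)) (y : ↥ΩT) (v : Sphere ι) :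
    tnorm n P (x.1 - (rbaseEmb hn ΩT y).1) / (n : ℝ) ≤ tsdist1 P x (srcQ F κ hn ΩT B y v.1) + 1 := by
  have hnr : (0 : ℝ) < (n : ℝ) := by exact_mod_cast hn
  have key : tnorm n P (x.1 - (rbaseEmb hn ΩT y).1) / (n : ℝ) - 1 ≤ tsdist1 P x (srcQ F κ hn ΩT B y v.1) := by
    refine le_tsdist1 P x _ ⟨_, base_mem_tsupp_srcQ hn F κ B y v⟩ fun z hz => ?_
    have hb := blk_eq_of_mem_tsupp_srcQ hn F κ B y v.1 hz
    have h1 : tnorm n P (z.1 - (rbaseEmb hn ΩT y).1) ≤ (n : ℝ) :=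
      (tnorm_le_supNorm hn hP _).trans (supNorm_sub_base_le hn hb)
    have h2 : tnorm n P (x.1 - (rbaseEmb hn ΩT y).1) ≤ tnorm n P (x.1 - z.1) + tnorm n P (z.1 - (rbaseEmb hn ΩT y).1) := by
      rw [← sub_add_sub_cancel x.1 z.1 (rbaseEmb hn ΩT y).1]; exact tnorm_add_le hn hP _ _
    rw [sub_le_iff_le_add, div_add_one hnr.ne', div_le_div_iff_of_pos_right hnr]
    linarith
  linarith

include hP in
/-- **`dist_T(L^ky, Ω^c) ≤ dist_T(supp f_{y,v}, Ω^c) + 1`**. [cite: Balaban1982Higgs2, Prop. 2.2 p.571 «dist(y, Ω^c)», dictionary] -/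
theorem tydist_le_tbdistS_srcQ (y : ↥ΩT) (v : Sphere ι) :
    tcdist P (rbaseEmb hn ΩT y) ≤ tbdistS P (srcQ F κ hn ΩT B y v.1) + 1 := by
  have hnr : (0 : ℝ) < (n : ℝ) := by exact_mod_cast hn
  have key : tcdist P (rbaseEmb hn ΩT y) - 1 ≤ tbdistS P (srcQ F κ hn ΩT B y v.1) := by
    refine le_tbdistS P _ ⟨_, base_mem_tsupp_srcQ hn F κ B y v⟩ fun z hz => ?_
    have hb := blk_eq_of_mem_tsupp_srcQ hn F κ B y v.1 hz
    have h1 : tnorm n P ((rbaseEmb hn ΩT y).1 - z.1) ≤ (n : ℝ) := by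
      refine (tnorm_le_supNorm hn hP _).trans ?_
      rw [← B4TorusKernel.supNorm_neg, neg_sub]; exact supNorm_sub_base_le hn hb
    have h2 := tcdist_le_tcdist_add hn P hP (rbaseEmb hn ΩT y) z
    have h3 : tnorm n P ((rbaseEmb hn ΩT y).1 - z.1) / (n : ℝ) ≤ 1 := by rw [div_le_one hnr]; exact h1
    linarith
  linarith

end Torus

/-! ## §2. The dictionary instance for r01's torus family `torusPairFam`; boundedness of the kernel columns -/

section Family

variable (F : OrthFlow ι) {ℓ : ℕ} {amin aplus m2plus : ℝ}

omit [Fintype ι] [DecidableEq ι] in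
/-- `L^k ≥ 1`. [cite: Balaban1983RegularityDecay, (1.1) p.572, dictionary] -/
theorem one_le_nT (i : TorusPairInst d ℓ amin aplus m2plus) : 1 ≤ (ℓ + 1) ^ i.k :=
  Nat.one_le_pow i.k (ℓ + 1) (Nat.succ_pos ℓ)

/-- the torus bond function `A_ν(x)` of the member on a label set. [cite: Balaban1983RegularityDecay, p.572 (1.2), dictionary] -/
abbrev tbond (i : TorusPairInst d ℓ amin aplus m2plus) (Ω' : Finset (Fin (d + 1) → ℤ)) :
    ↥(fineDom ((ℓ + 1) ^ i.k) Ω') → ↥(fineDom ((ℓ + 1) ^ i.k) Ω') → ℝ :=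
  fun u v => torBond ((ℓ + 1) ^ i.k) i.P i.Ac u.1 v.1

/-- **`P_k(A) = Q_k(A)^*Q_k(A)` INSIDE THE TORUS CARRIER'S OPERATOR (1.6)** (definitional): `H = −Δ_A + m² + a_k·(avgQ)ᵀ(avgQ)`.
[cite: Balaban1983RegularityDecay, (1.5)–(1.6) p.572 «operators on subsets of a torus T_η»] -/
theorem HT_eq_avgQ (i : TorusPairInst d ℓ amin aplus m2plus) :
    i.HT F = covLap (torWt ((ℓ + 1) ^ i.k) i.P (fineDom ((ℓ + 1) ^ i.k) i.ΩT)) (fieldLink F i.κ (tbond i i.ΩT))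
      + i.m2 • (1 : Matrix _ _ ℝ)
      + (i.aK * ((((ℓ + 1) ^ i.k : ℕ) : ℝ) ^ (d + 1))⁻¹) •
          ((avgQ F i.κ (one_le_nT i) i.ΩT (tbond i i.ΩT))ᵀ * avgQ F i.κ (one_le_nT i) i.ΩT (tbond i i.ΩT)) := rfl

/-- **THE SOURCE `f_{y,v} = Q_k^*(A)(vδ_y)` OF THE MEMBER** on the torus region `Ω`. [cite: Balaban1982Higgs2, Prop. 2.2 p.570 «Q_k^*(A)»] -/
def tsrc (i : TorusPairInst d ℓ amin aplus m2plus) (y : ↥i.ΩT) (v : ι → ℝ) :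
    ↥(fineDom ((ℓ + 1) ^ i.k) i.ΩT) × ι → ℝ :=
  srcQ F i.κ (one_le_nT i) i.ΩT (tbond i i.ΩT) y v

/-- the same source read on `Ω₀`. [cite: Balaban1982Higgs2, Prop. 2.2 p.571 «δG_k(Ω,Ω₀,A)Q_k^*(A)»] -/
def tsrc₀ (i : TorusPairInst d ℓ amin aplus m2plus) (y : ↥i.ΩT) (v : ι → ℝ) :
    ↥(fineDom ((ℓ + 1) ^ i.k) i.Ω₀T) × ι → ℝ :=
  srcQ F i.κ (one_le_nT i) i.Ω₀T (tbond i i.Ω₀T) (B4RegionCubeCarrier.inclY i.hsub y) v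

omit [Fintype ι] [DecidableEq ι] in
/-- the base corner `L^ky` of `B^k(y)` (the point `y ∈ T_1^{(k)} ⊂ T_η`). [cite: Balaban1982Higgs1, p.605 «T_1^{(k)} ⊂ T_η», dictionary] -/
def tbase (i : TorusPairInst d ℓ amin aplus m2plus) (y : ↥i.ΩT) : ↥(fineDom ((ℓ + 1) ^ i.k) i.ΩT) :=
  rbaseEmb (one_le_nT i) i.ΩT y

omit [Fintype ι] [DecidableEq ι] in
/-- **`dist(x, y)`** on the torus: `|x − L^ky|_T` in unit-lattice units. [cite: Balaban1982Higgs2, (2.58) p.570 «dist(b, y)», dictionary] -/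
def tldist (i : TorusPairInst d ℓ amin aplus m2plus) (x : ↥(fineDom ((ℓ + 1) ^ i.k) i.ΩT)) (y : ↥i.ΩT) : ℝ :=
  tnorm ((ℓ + 1) ^ i.k) i.P (x.1 - (tbase i y).1) / ((((ℓ + 1) ^ i.k : ℕ) : ℝ))

/-- **`E(Q_k^{*,Ω}(A)(vδ_y)) = Q_k^{*,Ω₀}(A)(vδ_y)`** on the torus. [cite: Balaban1982Higgs2, Prop. 2.2 p.571 «δG_k(Ω,Ω₀,A)Q_k^*(A)», dictionary] -/
theorem extT_tsrc (i : TorusPairInst d ℓ amin aplus m2plus) (y : ↥i.ΩT) (v : ι → ℝ) :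
    i.extT (tsrc F i y v) = tsrc₀ F i y v := by
  funext p
  obtain ⟨x0, j⟩ := p
  by_cases hp : blk ((ℓ + 1) ^ i.k) x0.1 ∈ i.ΩT
  · obtain ⟨x, rfl⟩ := (B4RegionCubeCarrier.inReg_iff (one_le_nT i) i.hsub x0).1 hp
    rw [i.extT_of_mem _ _ hp]
    show fld (tsrc F i y v) x j = fld (tsrc₀ F i y v) (B4RegionCubeCarrier.incl (one_le_nT i) i.hsub x) j
    rw [tsrc, tsrc₀, fld_srcQ, fld_srcQ, B4RegionCubeCarrier.contourTrans_incl]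
    rfl
  · rw [i.extT_of_not_mem _ _ hp]
    symm
    refine srcQ_apply_eq_zero_of_blk_ne F i.κ _ i.Ω₀T _ (B4RegionCubeCarrier.inclY i.hsub y) v ?_ j
    intro h
    exact hp (by rw [h]; exact y.2)

/-- `δG_k` is homogeneous on the torus. [cite: Balaban1983RegularityDecay, (1.11) p.573, dictionary] -/
theorem deltaT_smul (i : TorusPairInst d ℓ amin aplus m2plus) (c : ℝ) (f : ↥(fineDom ((ℓ + 1) ^ i.k) i.ΩT) × ι → ℝ) :
    i.deltaT F (c • f) = c • i.deltaT F f := by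
  have hE : i.extT (c • f) = c • i.extT f := by
    funext p
    by_cases hp : blk ((ℓ + 1) ^ i.k) p.1.1 ∈ i.ΩT
    · simp only [TorusPairInst.extT, dif_pos hp, Pi.smul_apply]
    · simp only [TorusPairInst.extT, dif_neg hp, Pi.smul_apply, smul_zero]
  have hR : ∀ g : ↥(fineDom ((ℓ + 1) ^ i.k) i.Ω₀T) × ι → ℝ, i.resT (c • g) = c • i.resT g := fun g => rfl
  simp only [TorusPairInst.deltaT, hE, Matrix.mulVec_smul, hR, smul_sub]

/-- **THE KERNEL COLUMNS ARE BOUNDED, HOMOGENEOUSLY IN `v`** — `G_kQ_k^*`. [cite: Balaban1982Higgs2, (2.58) p.570, dictionary] -/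
theorem valG_tsrc_le (i : TorusPairInst d ℓ amin aplus m2plus) (x : ↥(fineDom ((ℓ + 1) ^ i.k) i.ΩT)) (y : ↥i.ΩT) :
    ∃ C : ℝ, ∀ v, siteNorm (fld (i.GT F *ᵥ tsrc F i y v) x) ≤ C * siteNorm v := by
  refine ⟨Real.sqrt (Fintype.card ι) * ∑ j, ∑ q, |(i.GT F * (avgQ F i.κ (one_le_nT i) i.ΩT (tbond i i.ΩT))ᵀ) (x, j) q|,
    fun v => ?_⟩
  rw [tsrc, ← fld_mul_avgQ_transpose_mulVec_single, mul_assoc]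
  exact siteNorm_fld_mulVec_single_le _ x y v

/-- — `D^η_{A,μ}G_kQ_k^*`. [cite: Balaban1982Higgs2, (2.58) p.570, dictionary] -/
theorem valDG_tsrc_le (i : TorusPairInst d ℓ amin aplus m2plus) (μ : Fin (d + 1)) (x : ↥(fineDom ((ℓ + 1) ^ i.k) i.ΩT))
    (y : ↥i.ΩT) : ∃ C : ℝ, ∀ v, siteNorm (fld (i.DT F μ *ᵥ (i.GT F *ᵥ tsrc F i y v)) x) ≤ C * siteNorm v := by
  refine ⟨Real.sqrt (Fintype.card ι) *
      ∑ j, ∑ q, |(i.DT F μ * i.GT F * (avgQ F i.κ (one_le_nT i) i.ΩT (tbond i i.ΩT))ᵀ) (x, j) q|, fun v => ?_⟩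
  rw [Matrix.mulVec_mulVec, tsrc, ← fld_mul_avgQ_transpose_mulVec_single, mul_assoc]
  exact siteNorm_fld_mulVec_single_le _ x y v

/-- — `δG_kQ_k^*`. [cite: Balaban1982Higgs2, Prop. 2.2 p.571 «additional factor», dictionary] -/
theorem dvalG_tsrc_le (i : TorusPairInst d ℓ amin aplus m2plus) (x : ↥(fineDom ((ℓ + 1) ^ i.k) i.ΩT)) (y : ↥i.ΩT) :
    ∃ C : ℝ, ∀ v, siteNorm (fld (i.deltaT F (tsrc F i y v)) x) ≤ C * siteNorm v := by
  obtain ⟨C₁, h₁⟩ := valG_tsrc_le F i x y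
  refine ⟨C₁ + Real.sqrt (Fintype.card ι) *
      ∑ j, ∑ q, |(i.G₀T F * (avgQ F i.κ (one_le_nT i) i.Ω₀T (tbond i i.Ω₀T))ᵀ)
        (B4RegionCubeCarrier.incl (one_le_nT i) i.hsub x, j) q|, fun v => ?_⟩
  rw [i.fld_deltaT F, extT_tsrc, add_mul]
  refine (B4Lemma22HolderBox.siteNorm_sub_le _ _).trans (add_le_add (h₁ v) ?_)
  rw [tsrc₀, ← fld_mul_avgQ_transpose_mulVec_single, mul_assoc]
  exact siteNorm_fld_mulVec_single_le _ _ _ v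

/-- — `D^η_{A,μ}δG_kQ_k^*` on a torus bond `⟨x, x + ηe_μ⟩ ⊂ Ω`. [cite: Balaban1982Higgs2, Prop. 2.2 p.571 «additional factor», dictionary] -/
theorem dvalDG_tsrc_le (i : TorusPairInst d ℓ amin aplus m2plus) (μ : Fin (d + 1)) (x : ↥(fineDom ((ℓ + 1) ^ i.k) i.ΩT))
    (hx : twrap ((ℓ + 1) ^ i.k) i.P (x.1 + e1 μ) ∈ fineDom ((ℓ + 1) ^ i.k) i.ΩT) (y : ↥i.ΩT) :
    ∃ C : ℝ, ∀ v, siteNorm (fld (i.DT F μ *ᵥ i.deltaT F (tsrc F i y v)) x) ≤ C * siteNorm v := by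
  obtain ⟨C₁, h₁⟩ := valDG_tsrc_le F i μ x y
  refine ⟨C₁ + Real.sqrt (Fintype.card ι) *
      ∑ j, ∑ q, |(i.D₀T F μ * i.G₀T F * (avgQ F i.κ (one_le_nT i) i.Ω₀T (tbond i i.Ω₀T))ᵀ)
        (B4RegionCubeCarrier.incl (one_le_nT i) i.hsub x, j) q|, fun v => ?_⟩
  rw [i.fld_DT_deltaT F μ _ x hx, extT_tsrc, add_mul]
  refine (B4Lemma22HolderBox.siteNorm_sub_le _ _).trans (add_le_add (h₁ v) ?_)
  rw [Matrix.mulVec_mulVec, tsrc₀, ← fld_mul_avgQ_transpose_mulVec_single, mul_assoc]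
  exact siteNorm_fld_mulVec_single_le _ _ _ v

variable [Nonempty ι] (creg β : ℝ) (K : ℕ)

/-- **THE DICTIONARY INSTANCE OF `B2Prop22Proof` AT A MEMBER OF r01's TORUS FAMILY** (allowance `D = 1`): Prop.-I.2.1
instance `torusPairFam … i`; `y ∈ Ω^{(k)}` = the unit labels of `Ω`; torus bonds `b = ⟨b₋, b₋ + ηe_μ mod T⟩ ⊂ Ω` read at
`b₋`; test vectors = the unit sphere of `ℝ^N`; `f_{y,v} = Q_k^*(A)(vδ_y)`; distances in the torus sup-metric, `dist(x,y) =
|x − L^ky|_T`, `dist(y, Ωᶜ) = dist_T(L^ky, Ωᶜ)`. [cite: Balaban1982Higgs2, Prop. 2.2 (2.58) pp.570–571] -/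
def torDict (i : TorusPairInst d ℓ amin aplus m2plus) : Dict 1 where
  S := torusPairFam F d ℓ amin aplus m2plus creg β K i
  KSite := ↥i.ΩT
  Bond := {b : ↥(fineDom ((ℓ + 1) ^ i.k) i.ΩT) × Fin (d + 1) //
    twrap ((ℓ + 1) ^ i.k) i.P (b.1.1 + e1 b.2) ∈ fineDom ((ℓ + 1) ^ i.k) i.ΩT}
  base := fun b => b.1.1
  dir := fun b => b.1.2
  hDir := ⟨(0 : Fin (d + 1))⟩
  V := Sphere ι
  hV := sphere_nonempty
  src := fun y v => tsrc F i y v.1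
  dxy := fun x y => tldist i x y
  dby := fun b y => tldist i b.1.1 y
  bdistB := fun b => tcdist i.P b.1.1
  ydist := fun y => tcdist i.P (tbase i y)
  supNorm_src := fun y v =>
    (supN_srcQ_le F i.κ (one_le_nT i) i.ΩT (tbond i i.ΩT) y v.1).trans (le_of_eq v.2)
  dxy_le := fun x y v => tdxy_le_tsdist1_srcQ (one_le_nT i) i.P i.hP F i.κ (tbond i i.ΩT) x y v
  ydist_le := fun y v => tydist_le_tbdistS_srcQ (one_le_nT i) i.P i.hP F i.κ (tbond i i.ΩT) y v
  dby_le := fun _ _ => le_rfl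
  bdistB_le := fun _ => le_rfl

/-- the linked kernel `|(G_kQ_k^*)(x,y)|` is `sup_{|v|=1}|(G_k(Ω,A)f_{y,v})(x)|` (definitional). [cite: Balaban1982Higgs2, (2.58) p.570] -/
theorem kGQ_torDict (i : TorusPairInst d ℓ amin aplus m2plus) (x : ↥(fineDom ((ℓ + 1) ^ i.k) i.ΩT)) (y : ↥i.ΩT) :
    (torDict F creg β K i).toP22.kGQ x y = ⨆ u : Sphere ι, siteNorm (fld (i.GT F *ᵥ tsrc F i y u.1) x) := rfl

end Family

/-! ## §3. PROPOSITION 2.2 AT A REGULAR FIELD on the torus family; (2.58) explicitly; the whole torus -/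

section Main

variable [Nonempty ι] (F : OrthFlow ι)

/-- **PROPOSITION 2.2 (2.58) HOLDS AT EVERY (I.2.23)/(1.7)-REGULAR VECTOR FIELD ON THE FAMILY OF TORUS REGION PAIRS
`Ω ⊂ Ω₀ ⊂ T_η`** — r14's typed `B2StepK.Prop22Printed` for the linked family: for every orthogonal one-parameter flow (1.2)
with `|(U(t) − 1)v|² ≤ (ℓ₁t)²|v|²`, `L = ℓ+1 ≥ 2`, `a₋ > 0`, `c ≥ 0`, `β > 0` there are `δ₀, c₀, R₀, e₁ > 0` such that for
EVERY member (scale `k ≥ 1`, torus `T_η = Π_ν ℤ/(L^kP_ν)` with `Kmod ∣ P_ν`, pair `Ω ⊂ Ω₀ ⊂ T_η` of unions of `Kmod`-blocks,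
torus field `A` (1.7)-regular on `Ω₀`, coupling `0 < e ≤ e₁`) the four kernels of (2.58) obey the printed bounds at
`dist(b, Ωᶜ) ≥ R₀` resp. `dist(x, Ωᶜ) ≥ R₀` (p17's `prop22Printed_of_B4clause` ∘ α = 0 clause of r01's
`thmPrintedNN_torusPairFam`). [cite: Balaban1982Higgs2, Prop. 2.2 (2.58) pp.570–571] -/
theorem prop22Printed_torusPairFam {ℓ₁ : ℝ} (hℓ₁ : 0 ≤ ℓ₁)
    (hLip : ∀ t (v : ι → ℝ), ((F.U t - 1) *ᵥ v) ⬝ᵥ ((F.U t - 1) *ᵥ v) ≤ (ℓ₁ * t) ^ 2 * (v ⬝ᵥ v))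
    (d ℓ : ℕ) (hℓ : 1 ≤ ℓ) (amin aplus m2plus : ℝ) (ha : 0 < amin) (creg β : ℝ) (hcreg : 0 ≤ creg) (hβ : 0 < β) :
    B2StepK.Prop22Printed (fun i : TorusPairInst d ℓ amin aplus m2plus =>
      (torDict F creg β (Kmod F hℓ₁ hLip d ℓ hℓ amin aplus m2plus ha) i).toP22) :=
  prop22Printed_of_B4clause zero_le_one _ 0
    (thmPrintedNN_torusPairFam F hℓ₁ hLip d ℓ hℓ amin aplus m2plus ha creg β hcreg hβ 0 le_rfl zero_lt_one)

/-- **The statement for the PRINTED link variables (1.2) `U(A) = e^{qeηA}`**, every antisymmetric `q`.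
[cite: Balaban1982Higgs2, Prop. 2.2 (2.58) pp.570–571; Balaban1983RegularityDecay, (1.2) p.572] -/
theorem prop22Printed_torusPairFam_exp (q : Matrix ι ι ℝ) (hq : qᵀ = -q)
    (d ℓ : ℕ) (hℓ : 1 ≤ ℓ) (amin aplus m2plus : ℝ) (ha : 0 < amin) (creg β : ℝ) (hcreg : 0 ≤ creg) (hβ : 0 < β) :
    B2StepK.Prop22Printed (fun i : TorusPairInst d ℓ amin aplus m2plus =>
      (torDict (expFlow q hq) creg β
        (Kmod (expFlow q hq) (Real.sqrt_nonneg _) (expFlow_lipschitz q hq) d ℓ hℓ amin aplus m2plus ha) i).toP22) :=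
  prop22Printed_torusPairFam (expFlow q hq) (Real.sqrt_nonneg _) (expFlow_lipschitz q hq) d ℓ hℓ amin aplus m2plus ha
    creg β hcreg hβ

/-- **Non-vacuity for the record** (r01's `B4ThmTorusPairEta.hypotheses_met`). [cite: Balaban1982Higgs2, Prop. 2.2 p.570] -/
theorem torusPairFam_nonvacuous {ℓ₁ : ℝ} (hℓ₁ : 0 ≤ ℓ₁)
    (hLip : ∀ t (v : ι → ℝ), ((F.U t - 1) *ᵥ v) ⬝ᵥ ((F.U t - 1) *ᵥ v) ≤ (ℓ₁ * t) ^ 2 * (v ⬝ᵥ v))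
    (d ℓ : ℕ) (hℓ : 1 ≤ ℓ) {amin aplus m2plus : ℝ} (ha : 0 < amin) (hap : amin ≤ aplus) (hm : 0 ≤ m2plus)
    (creg β : ℝ) (hcreg : 0 ≤ creg) (e₁ : ℝ) (he₁ : 0 < e₁) :
    ∃ i : TorusPairInst d ℓ amin aplus m2plus,
      (torDict F creg β (Kmod F hℓ₁ hLip d ℓ hℓ amin aplus m2plus ha) i).toP22.regular ∧
      (torDict F creg β (Kmod F hℓ₁ hLip d ℓ hℓ amin aplus m2plus ha) i).toP22.bigBlocks ∧
      0 < (torDict F creg β (Kmod F hℓ₁ hLip d ℓ hℓ amin aplus m2plus ha) i).toP22.e ∧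
      (torDict F creg β (Kmod F hℓ₁ hLip d ℓ hℓ amin aplus m2plus ha) i).toP22.e ≤ e₁ :=
  B4ThmTorusPairEta.hypotheses_met F d ℓ hap hm creg β hcreg _
    (le_trans (by norm_num) (Classical.choose_spec
      (B4ThmRegionPairEta.region_pair_members F hℓ₁ hLip d ℓ hℓ amin aplus m2plus ha)).1) e₁ he₁

/-- **(2.58) EXPLICITLY ON THE TORUS, ALL FOUR CLAUSES, AT EVERY REGULAR FIELD** (torus sup-metric, unit-lattice units,
`dist(x,y) = |x − L^ky|_T`): there are `δ₀, c₀, R₀, e₁ > 0` such that for every member as above, every `x ∈ Ω` with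
`dist_T(x, Ωᶜ) ≥ R₀`, every `y ∈ Ω^{(k)}` and every `v ∈ ℝ^N`: `|(G_k(Ω,A)Q_k^*(A))(x,y)v| ≤ c₀e^{−δ₀dist(x,y)}|v|`; on every
torus bond `⟨x, x+ηe_μ⟩ ⊂ Ω`: `|(D^η_{A,μ}G_k(Ω,A)Q_k^*(A))(x,y)v| ≤ c₀e^{−δ₀dist(x,y)}|v|`; and the two `δG_k(Ω,Ω₀,A)` versions
with the additional factor `exp(−δ₀(dist(x,Ωᶜ) + dist(y,Ωᶜ)))`. [cite: Balaban1982Higgs2, Prop. 2.2 (2.58) pp.570–571] -/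
theorem ineq258_torusPairFam {ℓ₁ : ℝ} (hℓ₁ : 0 ≤ ℓ₁)
    (hLip : ∀ t (v : ι → ℝ), ((F.U t - 1) *ᵥ v) ⬝ᵥ ((F.U t - 1) *ᵥ v) ≤ (ℓ₁ * t) ^ 2 * (v ⬝ᵥ v))
    (d ℓ : ℕ) (hℓ : 1 ≤ ℓ) (amin aplus m2plus : ℝ) (ha : 0 < amin) (creg β : ℝ) (hcreg : 0 ≤ creg) (hβ : 0 < β) :
    ∃ δ₀ c₀ R₀ e₁ : ℝ, 0 < δ₀ ∧ 0 < c₀ ∧ 0 < R₀ ∧ 0 < e₁ ∧ ∀ i : TorusPairInst d ℓ amin aplus m2plus,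
      (torusPairFam F d ℓ amin aplus m2plus creg β (Kmod F hℓ₁ hLip d ℓ hℓ amin aplus m2plus ha) i).regular →
      (torusPairFam F d ℓ amin aplus m2plus creg β (Kmod F hℓ₁ hLip d ℓ hℓ amin aplus m2plus ha) i).bigBlocks →
      0 < i.e → i.e ≤ e₁ →
      ∀ (x : ↥(fineDom ((ℓ + 1) ^ i.k) i.ΩT)) (y : ↥i.ΩT) (v : ι → ℝ), R₀ ≤ tcdist i.P x →
        siteNorm (fld (i.GT F *ᵥ tsrc F i y v) x) ≤ c₀ * Real.exp (-(δ₀ * tldist i x y)) * siteNorm v ∧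
        (∀ μ : Fin (d + 1), twrap ((ℓ + 1) ^ i.k) i.P (x.1 + e1 μ) ∈ fineDom ((ℓ + 1) ^ i.k) i.ΩT →
          siteNorm (fld (i.DT F μ *ᵥ (i.GT F *ᵥ tsrc F i y v)) x) ≤ c₀ * Real.exp (-(δ₀ * tldist i x y)) * siteNorm v) ∧
        siteNorm (fld (i.deltaT F (tsrc F i y v)) x)
          ≤ c₀ * Real.exp (-(δ₀ * tldist i x y)) * Real.exp (-(δ₀ * (tcdist i.P x + tcdist i.P (tbase i y)))) * siteNorm v ∧
        (∀ μ : Fin (d + 1), twrap ((ℓ + 1) ^ i.k) i.P (x.1 + e1 μ) ∈ fineDom ((ℓ + 1) ^ i.k) i.ΩT →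
          siteNorm (fld (i.DT F μ *ᵥ i.deltaT F (tsrc F i y v)) x)
            ≤ c₀ * Real.exp (-(δ₀ * tldist i x y)) * Real.exp (-(δ₀ * (tcdist i.P x + tcdist i.P (tbase i y))))
              * siteNorm v) := by
  obtain ⟨δ₀, c₀, R₀, e₁, hδ, hc, hR, he, H⟩ :=
    prop22Printed_torusPairFam F hℓ₁ hLip d ℓ hℓ amin aplus m2plus ha creg β hcreg hβ
  refine ⟨δ₀, c₀, R₀, e₁, hδ, hc, hR, he, fun i hreg hbig he0 he1 x y v hx => ?_⟩
  obtain ⟨h1, h2, h3, h4⟩ := H i hreg hbig he0 he1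
  have hsm : ∀ (c : ℝ) (w : ι → ℝ), tsrc F i y (c • w) = c • tsrc F i y w :=
    fun c w => srcQ_smul F i.κ (one_le_nT i) i.ΩT (tbond i i.ΩT) y c w
  refine ⟨?_, fun μ hμ => ?_, ?_, fun μ hμ => ?_⟩
  · refine homog_bound_of_sphere (g := fun w => siteNorm (fld (i.GT F *ᵥ tsrc F i y w) x)) (fun c w hc0 => ?_)
      (fun u => ?_) v
    · simp only [hsm, Matrix.mulVec_smul]
      rw [show fld (c • (i.GT F *ᵥ tsrc F i y w)) x = c • fld (i.GT F *ᵥ tsrc F i y w) x from rfl, siteNorm_smul,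
        abs_of_nonneg hc0]
    · obtain ⟨C, hC⟩ := valG_tsrc_le F i x y
      exact (le_ciSup (bddAbove_sphere_of_homog hC) u).trans (h2 x y hx)
  · refine homog_bound_of_sphere (g := fun w => siteNorm (fld (i.DT F μ *ᵥ (i.GT F *ᵥ tsrc F i y w)) x))
      (fun c w hc0 => ?_) (fun u => ?_) v
    · simp only [hsm, Matrix.mulVec_smul]
      rw [show fld (c • (i.DT F μ *ᵥ (i.GT F *ᵥ tsrc F i y w))) x = c • fld (i.DT F μ *ᵥ (i.GT F *ᵥ tsrc F i y w)) x
        from rfl, siteNorm_smul, abs_of_nonneg hc0]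
    · obtain ⟨C, hC⟩ := valDG_tsrc_le F i μ x y
      exact (le_ciSup (bddAbove_sphere_of_homog hC) u).trans (h1 ⟨(x, μ), hμ⟩ y hx)
  · refine homog_bound_of_sphere (g := fun w => siteNorm (fld (i.deltaT F (tsrc F i y w)) x)) (fun c w hc0 => ?_)
      (fun u => ?_) v
    · simp only [hsm, deltaT_smul]
      rw [show fld (c • i.deltaT F (tsrc F i y w)) x = c • fld (i.deltaT F (tsrc F i y w)) x from rfl, siteNorm_smul,
        abs_of_nonneg hc0]
    · obtain ⟨C, hC⟩ := dvalG_tsrc_le F i x y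
      exact (le_ciSup (bddAbove_sphere_of_homog hC) u).trans (h4 x y hx)
  · refine homog_bound_of_sphere (g := fun w => siteNorm (fld (i.DT F μ *ᵥ i.deltaT F (tsrc F i y w)) x))
      (fun c w hc0 => ?_) (fun u => ?_) v
    · simp only [hsm, deltaT_smul, Matrix.mulVec_smul]
      rw [show fld (c • (i.DT F μ *ᵥ i.deltaT F (tsrc F i y w))) x = c • fld (i.DT F μ *ᵥ i.deltaT F (tsrc F i y w)) x
        from rfl, siteNorm_smul, abs_of_nonneg hc0]
    · obtain ⟨C, hC⟩ := dvalDG_tsrc_le F i μ x hμ y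
      exact (le_ciSup (bddAbove_sphere_of_homog hC) u).trans (h3 ⟨(x, μ), hμ⟩ y hx)

omit [Nonempty ι] in
/-- **(2.58) ON THE WHOLE TORUS `Ω = T_η`, AT EVERY POINT AND EVERY BOND, NO `R₀` RESTRICTION** — p. 573 of
[Balaban1983RegularityDecay] («For some simple sets Ω, e.g. for rectangular parallelepipeds, the inequalities hold without any
restrictions on the points»; p. 572 identifies `T_η` with «a rectangular parallelepiped … with periodic conditions») — the case
in which the typed restriction `R₀ ≤ dist(x, Ωᶜ)` of `B2StepK.Prop22Printed` is never met (`dist_T(x, ∅) := 0`): for every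
member whose `Ω` is the whole torus, `|(G_k(T_η,A)Q_k^*(A))(x,y)v| ≤ c₀e^{−δ₀|x − L^ky|_T}|v|` for ALL `x`, and the
`D^η_{A,μ}` version on every bond (r01's `rect` branch of `Ineq19_110`, α = 0, `c₀ ↦ c₀e^{2δ₀}` as in p17's `bound_plain`).
[cite: Balaban1982Higgs2, Prop. 2.2 (2.58) p.570; Balaban1983RegularityDecay, Theorem p.573] -/
theorem ineq258_torus_rect {ℓ₁ : ℝ} (hℓ₁ : 0 ≤ ℓ₁)
    (hLip : ∀ t (v : ι → ℝ), ((F.U t - 1) *ᵥ v) ⬝ᵥ ((F.U t - 1) *ᵥ v) ≤ (ℓ₁ * t) ^ 2 * (v ⬝ᵥ v))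
    (d ℓ : ℕ) (hℓ : 1 ≤ ℓ) (amin aplus m2plus : ℝ) (ha : 0 < amin) (creg β : ℝ) (hcreg : 0 ≤ creg) (hβ : 0 < β) :
    ∃ δ₀ c₀ e₁ : ℝ, 0 < δ₀ ∧ 0 < c₀ ∧ 0 < e₁ ∧ ∀ i : TorusPairInst d ℓ amin aplus m2plus,
      (torusPairFam F d ℓ amin aplus m2plus creg β (Kmod F hℓ₁ hLip d ℓ hℓ amin aplus m2plus ha) i).regular →
      (torusPairFam F d ℓ amin aplus m2plus creg β (Kmod F hℓ₁ hLip d ℓ hℓ amin aplus m2plus ha) i).bigBlocks →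
      0 < i.e → i.e ≤ e₁ → fineDom ((ℓ + 1) ^ i.k) i.ΩT = boxDom (per ((ℓ + 1) ^ i.k) i.P) →
      ∀ (x : ↥(fineDom ((ℓ + 1) ^ i.k) i.ΩT)) (y : ↥i.ΩT) (v : ι → ℝ),
        siteNorm (fld (i.GT F *ᵥ tsrc F i y v) x) ≤ c₀ * Real.exp (-(δ₀ * tldist i x y)) * siteNorm v ∧
        (∀ μ : Fin (d + 1), twrap ((ℓ + 1) ^ i.k) i.P (x.1 + e1 μ) ∈ fineDom ((ℓ + 1) ^ i.k) i.ΩT →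
          siteNorm (fld (i.DT F μ *ᵥ (i.GT F *ᵥ tsrc F i y v)) x) ≤ c₀ * Real.exp (-(δ₀ * tldist i x y)) * siteNorm v) := by
  obtain ⟨δ₀, c₀, R₀, e₁, hδ, hc, _, he, H⟩ :=
    thmPrintedNN_torusPairFam F hℓ₁ hLip d ℓ hℓ amin aplus m2plus ha creg β hcreg hβ 0 le_rfl zero_lt_one
  refine ⟨δ₀, c₀ * Real.exp (2 * δ₀ * 1), e₁, hδ, by positivity, he, fun i hreg hbig he0 he1 hrect x y v => ?_⟩
  obtain ⟨_, h10⟩ := (H i hreg hbig he0 he1).1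
  -- (1.10) at the source `f_{y,u}`, `u` on the unit sphere, with the `rect` waiver
  have hpt : ∀ (u : Sphere ι) (μ : Fin (d + 1)),
      siteNorm (fld (i.DT F μ *ᵥ (i.GT F *ᵥ tsrc F i y u.1)) x) ≤ c₀ * Real.exp (2 * δ₀ * 1) * Real.exp (-(δ₀ * tldist i x y))
      ∧ siteNorm (fld (i.GT F *ᵥ tsrc F i y u.1) x) ≤ c₀ * Real.exp (2 * δ₀ * 1) * Real.exp (-(δ₀ * tldist i x y)) := by
    intro u μ
    have h := h10 μ (tsrc F i y u.1) x (Or.inl hrect)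
    have hN : supN (tsrc F i y u.1) ≤ 1 :=
      (supN_srcQ_le F i.κ (one_le_nT i) i.ΩT (tbond i i.ΩT) y u.1).trans (le_of_eq u.2)
    have hst : tldist i x y ≤ tsdist1 i.P x (tsrc F i y u.1) + 1 :=
      tdxy_le_tsdist1_srcQ (one_le_nT i) i.P i.hP F i.κ (tbond i i.ΩT) x y u
    exact ⟨bound_plain hc.le hδ.le zero_le_one h.1 hN hst, bound_plain hc.le hδ.le zero_le_one h.2 hN hst⟩
  have hsm : ∀ (c : ℝ) (w : ι → ℝ), tsrc F i y (c • w) = c • tsrc F i y w :=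
    fun c w => srcQ_smul F i.κ (one_le_nT i) i.ΩT (tbond i i.ΩT) y c w
  refine ⟨?_, fun μ _ => ?_⟩
  · refine homog_bound_of_sphere (g := fun w => siteNorm (fld (i.GT F *ᵥ tsrc F i y w) x)) (fun c w hc0 => ?_)
      (fun u => (hpt u 0).2) v
    simp only [hsm, Matrix.mulVec_smul]
    rw [show fld (c • (i.GT F *ᵥ tsrc F i y w)) x = c • fld (i.GT F *ᵥ tsrc F i y w) x from rfl, siteNorm_smul,
      abs_of_nonneg hc0]
  · refine homog_bound_of_sphere (g := fun w => siteNorm (fld (i.DT F μ *ᵥ (i.GT F *ᵥ tsrc F i y w)) x))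
      (fun c w hc0 => ?_) (fun u => (hpt u μ).1) v
    simp only [hsm, Matrix.mulVec_smul]
    rw [show fld (c • (i.DT F μ *ᵥ (i.GT F *ᵥ tsrc F i y w))) x = c • fld (i.DT F μ *ᵥ (i.GT F *ᵥ tsrc F i y w)) x
      from rfl, siteNorm_smul, abs_of_nonneg hc0]

end Main

end

end Literature.MathematicalPhysics.QuantumFieldTheory.Balaban1983to89.B2Prop22RegularTorusPair
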